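import Summits.AtomisticToContinuum.Crystallization.Theorems.FreeSplittingCertificatesRadiusLadderPeriodicHalf
import Summits.AtomisticToContinuum.Crystallization.Theorems.FreeSplittingCertificatesFreePairSplitting

/-!
# `FiniteRangeSplitting` (stmt-AtomisticToContinuum-12559): the quotient splitting of a periodic configuration (any motif)

Companion of `FreeSplittingCertificatesRadiusLadder` (block-2b unit `b2b-freesplit-A`, gen 9).  VALUE = a theorem (RESULTS-R2 §6,
P3 made general and kernel-checked: an infinite-volume splitting certificate for EVERY periodic configuration of `ℝ³`) —
NOT summit progress; nothing here closes an item.  Its finite-fragment consequence (such configurations never refute a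
rung of the radius ladder) is `…RadiusLadderPeriodicQuotientFragments`.

`…RadiusLadderPeriodicHalf` / `…PeriodicHcp` / `…PeriodicFcc` dispose of SITE-HOMOGENEOUS attractive periodic
configurations (Bravais lattices, hcp, fcc) with the half rule `Φ ≡ 1/2`.  For `P = F + G` with an ARBITRARY motif `F`
(A15, C15, Laves phases, polytypes, …) the half rule fails at the cosets whose site sum is above the motif average.  The
repair is a splitting on the QUOTIENT `F ≅ (F + G)/G`:

* `cosetSum P p y' = Σ'_{z ∈ y'+G, z ≠ p} V_LJ(|p - z|)` — the interaction of a point with one sublattice; the site sum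
  is their motif sum (`latticeSiteSum_eq_sum_cosetSum`), they are translation invariant (`cosetSum_add`) and SYMMETRIC
  in the two cosets (`cosetSum_comm`, re-indexing `g ↦ -g`);
* for every non-empty sub-motif `F' ⊆ F` the sub-configuration `F' + G` (`subMotif`) is periodic, so `PeriodicUpperBound`
  (`periodicUpperBound_proof`, in the tree) gives `#F'·(2 e_∞) ≤ 2 #F' e(F'+G) = Σ_{y,y' ∈ F'} s_y(y')`
  (`sum_sum_cosetSum_eq`, `cut_le_sum_sum_cosetSum`) — exactly the CUT CONDITIONS of the landed supply–demand theorem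
  `FreePair.exists_splitting_of_cut` (`…FreePairSplitting`: Hoffman/Gale feasibility by LP duality) for the symmetric
  `#F × #F` matrix of coset pair sums;
* hence `exists_cosetSplitting`: COSET-PAIR WEIGHTS `θ_{yy'} ≥ 0`, `θ_{yy'} + θ_{y'y} = 1`, with
  `e_∞ ≤ Σ_{y' ∈ F} θ_{yy'} s_y(y')` at EVERY coset `y` — unconditional (no attractivity, no homogeneity).
-/

noncomputable section
namespace Summit.AtomisticToContinuum.Crystallization.Theorems.StrictSplittingRuleBirth

open scoped BigOperators Classical
open Literature.MathematicalPhysics.StatisticalMechanics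

/-- Euclidean `3`-space. -/
local notation "E3" => EuclideanSpace ℝ (Fin 3)

/-! ## Cosets (sublattices) of a periodic configuration and coset pair sums -/

variable (P : PeriodicConfiguration 3)

/-- The sublattice (coset) `y + G` of the lattice of periods through `y`. [folklore] -/
def coset (y : E3) : Set E3 := {z | ∃ g ∈ P.lattice, z = y + g}

/-- Membership in a coset: `z ∈ y + G ↔ z - y ∈ G`. -/
theorem mem_coset_iff {y z : E3} : z ∈ coset P y ↔ z - y ∈ P.lattice := by
  constructor
  · rintro ⟨g, hg, rfl⟩
    simpa using hg
  · intro h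
    exact ⟨z - y, h, by abel⟩

/-- Cosets of motif points consist of points of the configuration. -/
theorem coset_subset_points {y : E3} (hy : y ∈ P.motif) : coset P y ⊆ P.points :=
  fun _ ⟨g, hg, h⟩ => ⟨y, hy, g, hg, h⟩

/-- Cosets are invariant under lattice translations. -/
theorem add_mem_coset {y z g : E3} (hz : z ∈ coset P y) (hg : g ∈ P.lattice) : z + g ∈ coset P y := by
  rw [mem_coset_iff] at hz ⊢
  have : z + g - y = (z - y) + g := by abel
  rw [this]
  exact P.lattice.add_mem hz hg

/-- Every point of `F + G` lies in the coset of a motif point. -/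
theorem mem_points_iff {z : E3} : z ∈ P.points ↔ ∃ y ∈ P.motif, z ∈ coset P y :=
  ⟨fun ⟨y, hy, g, hg, h⟩ => ⟨y, hy, g, hg, h⟩, fun ⟨y, hy, g, hg, h⟩ => ⟨y, hy, g, hg, h⟩⟩

/-- Distinct motif points have disjoint cosets (motif points are pairwise inequivalent mod `G`). -/
theorem disjoint_coset {y y' : E3} (hy : y ∈ P.motif) (hy' : y' ∈ P.motif) (hne : y ≠ y') :
    Disjoint (coset P y) (coset P y') := by
  refine Set.disjoint_left.2 fun z hz hz' => hne ?_
  rw [mem_coset_iff] at hz hz'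
  refine P.eq_of_sub_mem y hy y' hy' ?_
  have : y - y' = (z - y') - (z - y) := by abel
  rw [this]
  exact P.lattice.sub_mem hz' hz

/-- **Coset labels are read mod `G`**: two points in cosets of motif points `y`, `y'` that differ by a lattice vector
have `y = y'`. -/
theorem rep_eq {y y' z z' : E3} (hy : y ∈ P.motif) (hy' : y' ∈ P.motif) (hz : z ∈ coset P y)
    (hz' : z' ∈ coset P y') (h : z - z' ∈ P.lattice) : y = y' := by
  rw [mem_coset_iff] at hz hz'
  refine P.eq_of_sub_mem y hy y' hy' ?_
  have : y - y' = (z' - y') - (z - y) + (z - z') := by abel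
  rw [this]
  exact P.lattice.add_mem (P.lattice.sub_mem hz' hz) h

/-- The COSET PAIR SUM `s_p(y') = Σ'_{z ∈ y'+G, z ≠ p} V_LJ(|p - z|)`: the interaction of the point `p` with the
sublattice `y' + G` (its own sublattice minus itself when `p ∈ y' + G`). [folklore] -/
def cosetSum (p y' : E3) : ℝ :=
  ∑' z : {z : E3 // z ∈ coset P y' ∧ z ≠ p}, lennardJones (dist p z.1)

/-- Coset pair sums of motif cosets converge absolutely (sub-family of the site lattice sum,
`PeriodicConfiguration.summable_lennardJones_dist_three`). -/
theorem summable_cosetSum {y' : E3} (hy' : y' ∈ P.motif) (p : E3) :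
    Summable fun z : {z : E3 // z ∈ coset P y' ∧ z ≠ p} => lennardJones (dist p z.1) := by
  let ι : {z : E3 // z ∈ coset P y' ∧ z ≠ p} → {z : E3 // z ∈ P.points ∧ z ≠ p} :=
    fun z => ⟨z.1, coset_subset_points P hy' z.2.1, z.2.2⟩
  have hι : Function.Injective ι := fun z z' h => by
    have h' := congrArg Subtype.val h
    exact Subtype.ext h'
  exact ((P.summable_lennardJones_dist_three p).comp_injective hι).congr fun _ => rfl

/-- **Lattice translations preserve coset pair sums**: `s_{p+g}(y') = s_p(y')` for `g ∈ G`. -/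
theorem cosetSum_add (p y' : E3) {g : E3} (hg : g ∈ P.lattice) :
    cosetSum P (p + g) y' = cosetSum P p y' := by
  let e : {z : E3 // z ∈ coset P y' ∧ z ≠ p} ≃ {z : E3 // z ∈ coset P y' ∧ z ≠ p + g} :=
    { toFun := fun z => ⟨z.1 + g, add_mem_coset P z.2.1 hg, fun h => z.2.2 (add_right_cancel h)⟩
      invFun := fun z => ⟨z.1 + -g, add_mem_coset P z.2.1 (P.lattice.neg_mem hg), fun h => z.2.2 (by
        rw [← sub_eq_add_neg] at h
        exact eq_add_of_sub_eq h)⟩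
      left_inv := fun z => Subtype.ext (by simp)
      right_inv := fun z => Subtype.ext (by simp) }
  unfold cosetSum
  rw [← Equiv.tsum_eq e]
  refine tsum_congr fun z => ?_
  show lennardJones (dist (p + g) (z.1 + g)) = lennardJones (dist p z.1)
  rw [dist_add_right]

/-- **Coset pair sums are symmetric**: `s_y(y') = s_{y'}(y)` (re-index the lattice sum by `g ↦ -g`, i.e.
`z ↦ y + y' - z`). -/
theorem cosetSum_comm (y y' : E3) : cosetSum P y y' = cosetSum P y' y := by
  have hmem : ∀ (a b z : E3), z ∈ coset P b → a + b - z ∈ coset P a := by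
    intro a b z hz
    rw [mem_coset_iff] at hz ⊢
    have : a + b - z - a = -(z - b) := by abel
    rw [this]
    exact P.lattice.neg_mem hz
  have hne : ∀ (a b z : E3), z ≠ a → a + b - z ≠ b := by
    intro a b z hz h
    apply hz
    have h1 : z = a + b - (a + b - z) := by abel
    rw [h, add_sub_cancel_right] at h1
    exact h1
  let e : {z : E3 // z ∈ coset P y' ∧ z ≠ y} ≃ {z : E3 // z ∈ coset P y ∧ z ≠ y'} :=
    { toFun := fun z => ⟨y + y' - z.1, hmem y y' z.1 z.2.1, hne y y' z.1 z.2.2⟩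
      invFun := fun z => ⟨y' + y - z.1, hmem y' y z.1 z.2.1, hne y' y z.1 z.2.2⟩
      left_inv := fun z => Subtype.ext (by
        show y' + y - (y + y' - z.1) = z.1
        abel)
      right_inv := fun z => Subtype.ext (by
        show y + y' - (y' + y - z.1) = z.1
        abel) }
  unfold cosetSum
  rw [← Equiv.tsum_eq e]
  refine tsum_congr fun z => ?_
  show lennardJones (dist y z.1) = lennardJones (dist y' (y + y' - z.1))
  congr 1
  rw [dist_eq_norm, dist_eq_norm]
  have : y' - (y + y' - z.1) = -(y - z.1) := by abel
  rw [this, norm_neg]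

/-- **The site sum is the motif sum of the coset pair sums**: `latticeSiteSum P p = Σ_{y' ∈ F} s_p(y')`
(`F + G` is the disjoint union of the cosets `y' + G`). -/
theorem latticeSiteSum_eq_sum_cosetSum (p : E3) :
    latticeSiteSum P p = ∑ y' ∈ P.motif, cosetSum P p y' := by
  let G : E3 → ℝ := fun z => lennardJones (dist p z)
  have hU : ∀ z : E3, (z ∈ P.points ∧ z ≠ p) ↔ z ∈ ⋃ y' ∈ P.motif, {z | z ∈ coset P y' ∧ z ≠ p} := by
    intro z
    simp only [Set.mem_iUnion, Set.mem_setOf_eq, exists_prop]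
    constructor
    · rintro ⟨hz, hzp⟩
      obtain ⟨y', hy', hzy'⟩ := (mem_points_iff P).1 hz
      exact ⟨y', hy', hzy', hzp⟩
    · rintro ⟨y', hy', hzy', hzp⟩
      exact ⟨coset_subset_points P hy' hzy', hzp⟩
  have hd : (P.motif : Set E3).Pairwise
      (Function.onFun Disjoint fun y' => {z | z ∈ coset P y' ∧ z ≠ p}) := by
    intro y hy y' hy' hyy'
    change Disjoint {z | z ∈ coset P y ∧ z ≠ p} {z | z ∈ coset P y' ∧ z ≠ p}
    refine Set.disjoint_left.2 fun z hz hz' => ?_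
    exact Set.disjoint_left.1 (disjoint_coset P hy hy' hyy') hz.1 hz'.1
  have hTs : ∀ y' ∈ P.motif, Summable (G ∘ (↑) : {z | z ∈ coset P y' ∧ z ≠ p} → ℝ) := by
    intro y' hy'
    exact summable_cosetSum P hy' p
  show (∑' z : {z : E3 // z ∈ P.points ∧ z ≠ p}, G z.1) = ∑ y' ∈ P.motif, cosetSum P p y'
  calc (∑' z : {z : E3 // z ∈ P.points ∧ z ≠ p}, G z.1)
      = ∑' z : (⋃ y' ∈ P.motif, {z | z ∈ coset P y' ∧ z ≠ p} : Set E3), G z :=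
        Equiv.tsum_eq (Equiv.subtypeEquivRight hU) (fun z => G z.1)
    _ = ∑ y' ∈ P.motif, ∑' z : {z | z ∈ coset P y' ∧ z ≠ p}, G z :=
        Summable.tsum_finset_bUnion_disjoint (f := G) hd hTs
    _ = ∑ y' ∈ P.motif, cosetSum P p y' := rfl

/-! ## Sub-motif configurations and the cut condition -/

/-- The SUB-CONFIGURATION `F' + G` of `P = F + G` on a non-empty sub-motif `F' ⊆ F` (same lattice of periods).
[folklore] -/
def subMotif (F' : Finset E3) (hF' : F'.Nonempty) (hsub : F' ⊆ P.motif) : PeriodicConfiguration 3 where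
  lattice := P.lattice
  discrete := P.discrete
  isZLattice := P.isZLattice
  motif := F'
  motif_nonempty := hF'
  eq_of_sub_mem := fun x hx y hy h => P.eq_of_sub_mem x (hsub hx) y (hsub hy) h

/-- **Energy of a sub-motif configuration** = the double coset sum: `Σ_{y,y' ∈ F'} s_y(y') = 2·#F'·e(F' + G)`. -/
theorem sum_sum_cosetSum_eq (F' : Finset E3) (hF' : F'.Nonempty) (hsub : F' ⊆ P.motif) :
    ∑ y ∈ F', ∑ y' ∈ F', cosetSum P y y' =
      2 * (F'.card : ℝ) * (subMotif P F' hF' hsub).energyPerParticle lennardJones := by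
  have hF : (F'.card : ℝ) ≠ 0 := Nat.cast_ne_zero.2 (Finset.card_pos.2 hF').ne'
  rw [energyPerParticle_eq_sum_latticeSiteSum]
  show ∑ y ∈ F', ∑ y' ∈ F', cosetSum P y y' =
    2 * (F'.card : ℝ) * ((2 * (F'.card : ℝ))⁻¹ * ∑ y ∈ F', latticeSiteSum (subMotif P F' hF' hsub) y)
  rw [Finset.sum_congr rfl fun y _ => latticeSiteSum_eq_sum_cosetSum (subMotif P F' hF' hsub) y]
  show ∑ y ∈ F', ∑ y' ∈ F', cosetSum P y y' =
    2 * (F'.card : ℝ) * ((2 * (F'.card : ℝ))⁻¹ * ∑ y ∈ F', ∑ y' ∈ F', cosetSum P y y')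
  rw [← mul_assoc, mul_inv_cancel₀ (mul_ne_zero two_ne_zero hF), one_mul]

/-- **The cut condition of the quotient**: for every set `S` of cosets, `#S·(2 e_∞) ≤ Σ_{y,y' ∈ S} s_y(y')` —
`PeriodicUpperBound` (`periodicUpperBound_proof`) applied to the sub-motif configuration `S + G`. -/
theorem cut_le_sum_sum_cosetSum (F' : Finset E3) (hsub : F' ⊆ P.motif) :
    (F'.card : ℝ) * (2 * eInf) ≤ ∑ y ∈ F', ∑ y' ∈ F', cosetSum P y y' := by
  rcases F'.eq_empty_or_nonempty with rfl | hF'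
  · simp
  · rw [sum_sum_cosetSum_eq P F' hF' hsub]
    have hub : eInf ≤ (subMotif P F' hF' hsub).energyPerParticle lennardJones := periodicUpperBound_proof _
    have hpos : (0 : ℝ) ≤ 2 * (F'.card : ℝ) := by positivity
    nlinarith

/-! ## The quotient splitting -/

/-- **Every periodic configuration admits a coset-pair splitting (P3, general motif).**  For every periodic
configuration `P = F + G` of `ℝ³` there are weights `θ_{yy'} ≥ 0` with `θ_{yy'} + θ_{y'y} = 1` such that at EVERY
coset `y ∈ F` the `θ`-weighted site sum is at least the ground-state energy per particle:
`e_∞ ≤ Σ_{y' ∈ F} θ_{yy'} · s_y(y')`.  Proof: the supply–demand theorem `FreePair.exists_splitting_of_cut` for the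
symmetric matrix of coset pair sums, whose cut conditions are `cut_le_sum_sum_cosetSum`.  (For a site-homogeneous
`P` the half weights `θ ≡ 1/2` already work — `energyPerParticle_eq_latticeSiteSum`; in general the cosets with
site sum above the motif average must import weight from the others.) -/
theorem exists_cosetSplitting :
    ∃ θ : E3 → E3 → ℝ, (∀ y y', 0 ≤ θ y y') ∧ (∀ y y', θ y y' + θ y' y = 1) ∧
      ∀ y ∈ P.motif, eInf ≤ ∑ y' ∈ P.motif, θ y y' * cosetSum P y y' := by
  classical
  let σ : Fin P.motif.card ≃ {y // y ∈ P.motif} := P.motif.equivFin.symm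
  let V : Fin P.motif.card → Fin P.motif.card → ℝ := fun i j => cosetSum P (σ i) (σ j)
  have hsymm : ∀ i j, V i j = V j i := fun i j => cosetSum_comm P _ _
  have hcut : ∀ S : Finset (Fin P.motif.card), (S.card : ℝ) * (2 * eInf) ≤ ∑ i ∈ S, ∑ j ∈ S, V i j := by
    intro S
    let emb : Fin P.motif.card ↪ E3 := ⟨fun i => (σ i : E3), fun i j h => σ.injective (Subtype.ext h)⟩
    have hsub : S.map emb ⊆ P.motif := by
      intro y hy
      obtain ⟨i, -, rfl⟩ := Finset.mem_map.1 hy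
      exact (σ i).2
    have hsum : ∑ i ∈ S, ∑ j ∈ S, V i j = ∑ y ∈ S.map emb, ∑ y' ∈ S.map emb, cosetSum P y y' := by
      simp only [Finset.sum_map]
      rfl
    rw [hsum, ← Finset.card_map emb]
    exact cut_le_sum_sum_cosetSum P (S.map emb) hsub
  obtain ⟨w, hw0, hw1, hrow⟩ := FreePair.exists_splitting_of_cut V hsymm eInf hcut
  let θ : E3 → E3 → ℝ := fun y y' =>
    if h : y ∈ P.motif ∧ y' ∈ P.motif then w (σ.symm ⟨y, h.1⟩) (σ.symm ⟨y', h.2⟩) else 1 / 2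
  refine ⟨θ, ?_, ?_, ?_⟩
  · intro y y'
    by_cases h : y ∈ P.motif ∧ y' ∈ P.motif
    · simp only [θ, dif_pos h]
      exact hw0 _ _
    · simp only [θ, dif_neg h]
      norm_num
  · intro y y'
    by_cases h : y ∈ P.motif ∧ y' ∈ P.motif
    · have h' : y' ∈ P.motif ∧ y ∈ P.motif := ⟨h.2, h.1⟩
      simp only [θ, dif_pos h, dif_pos h']
      exact hw1 _ _
    · have h' : ¬ (y' ∈ P.motif ∧ y ∈ P.motif) := fun h' => h ⟨h'.2, h'.1⟩
      simp only [θ, dif_neg h, dif_neg h']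
      norm_num
  · intro y hy
    have hyi : (σ (σ.symm ⟨y, hy⟩) : E3) = y := by
      rw [Equiv.apply_symm_apply]
    have hconv : ∑ j, w (σ.symm ⟨y, hy⟩) j * V (σ.symm ⟨y, hy⟩) j =
        ∑ y' ∈ P.motif, θ y y' * cosetSum P y y' := by
      rw [← Finset.sum_coe_sort P.motif]
      refine Fintype.sum_equiv σ _ _ fun j => ?_
      have hm : y ∈ P.motif ∧ (σ j : E3) ∈ P.motif := ⟨hy, (σ j).2⟩
      have hθ : θ y (σ j : E3) = w (σ.symm ⟨y, hy⟩) j := by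
        simp only [θ, dif_pos hm, Subtype.coe_eta, Equiv.symm_apply_apply]
      rw [hθ]
      show w (σ.symm ⟨y, hy⟩) j * cosetSum P (σ (σ.symm ⟨y, hy⟩)) (σ j) = _
      rw [hyi]
    have h := hrow (σ.symm ⟨y, hy⟩)
    rwa [hconv] at h

end Summit.AtomisticToContinuum.Crystallization.Theorems.StrictSplittingRuleBirth

end
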